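import Mathlib.RingTheory.Ideal.Quotient.Operations
import Mathlib.RingTheory.Regular.RegularSequence
import Mathlib.RingTheory.Ideal.Maps
import HarnessLib

/-!
# The levels `S / t^a S` of an adic tower and their structure maps

Topic `Literature/RingTheory/RegularLocalRing`. For a commutative ring `S` and `t ∈ S`, the
`S`-algebras `AdicLevel.C t a := S ⧸ (t^a)` (`a ≥ 0`), the reduction maps
`AdicLevel.red t a b : S/(t^a) →ₐ[S] S/(t^b)` (`b ≤ a`) and the `S`-linear maps
`AdicLevel.tup t a b : S/(t^b) → S/(t^a)`, "multiplication by `t^{a-b}`". These are the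
infinitesimal neighbourhoods `X_n` of the hypersurface `V(t)` and the exact sequences
`0 → 𝒪_{X_b} →^{t^{a-b}} 𝒪_{X_a} → 𝒪_{X_{a-b}} → 0` of SGA 2 XI §1 (for `t` regular), in the
form consumed by the abstract tower `AdicTower.lean` and the cocycle lifting
`CechCocycleLifting.lean` for the complete case `hC` of
`Grothendieck1968_samuelConjecture_hypersurface`:

* `red_tup`, `tup_red` (`= t^{a-b} •`), `red_red`, `tup_tup`, `red_tup_sub` (`= 0`),
  `tup_red_mul` (semilinearity), `red_surjective`;
* for `t` a non-zero-divisor: `tup_injective`, `exists_tup_eq_of_red_eq_zero`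
  (`ker red_{a→b} = im tup_{(a-b)→a}`);
* `mul_eq_zero_of_red_succ_eq_zero` — the kernel of `S/(t^{a+1}) → S/(t^a)` has square zero
  for `a ≥ 1`; `kerRedSuccEquiv` — it is `S`-linearly isomorphic to `S/(t)` (via `t^a`), so
  regular sequences transfer (`isWeaklyRegular_ker_red_succ`);
* `subsingleton_C_zero` — level `0` is the zero ring.

Everything is proved; the only definitions are `C`, `red`, `tup`, `kerRedSuccEquiv`.

## References

* [Grothendieck1968SGA2] A. Grothendieck, SGA 2, Exp. XI §1, (1.1) (arXiv:math/0511279, p. 68).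
-/

noncomputable section

universe u

namespace Literature.RingTheory.RegularLocalRing

namespace AdicLevel

open nonZeroDivisors

variable {S : Type u} [CommRing S] (t : S)

/-- The level `S ⧸ (t^a)`. [folklore] -/
abbrev C (a : ℕ) : Type u := S ⧸ Ideal.span {t ^ a}

/-- `(t^a) ⊆ (t^b)` for `b ≤ a`. [folklore] -/
theorem span_pow_le {a b : ℕ} (h : b ≤ a) : Ideal.span {t ^ a} ≤ Ideal.span ({t ^ b} : Set S) :=
  Ideal.span_singleton_le_span_singleton.mpr (pow_dvd_pow t h)

/-- **Reduction** `S ⧸ (t^a) → S ⧸ (t^b)`, an `S`-algebra map. [folklore] -/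
def red (a b : ℕ) (h : b ≤ a) : C t a →ₐ[S] C t b :=
  Ideal.Quotient.factorₐ S (span_pow_le t h)

/-- `red` on classes. [folklore] -/
@[simp] theorem red_mk (a b : ℕ) (h : b ≤ a) (x : S) :
    red t a b h (Ideal.Quotient.mk _ x) = Ideal.Quotient.mk _ x := rfl

/-- `t^{a-b} x ∈ (t^a)` for `x ∈ (t^b)`. [folklore] -/
theorem span_pow_le_comap (a b : ℕ) (h : b ≤ a) :
    (Ideal.span {t ^ b} : Submodule S S) ≤
      Submodule.comap (t ^ (a - b) • (LinearMap.id : S →ₗ[S] S)) (Ideal.span {t ^ a}) := by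
  intro x hx
  obtain ⟨c, rfl⟩ := Ideal.mem_span_singleton'.mp hx
  change t ^ (a - b) • (c * t ^ b) ∈ Ideal.span {t ^ a}
  rw [smul_eq_mul, show t ^ (a - b) * (c * t ^ b) = c * t ^ a by
    rw [mul_left_comm, ← pow_add, Nat.sub_add_cancel h, mul_comm]]
  exact Ideal.mul_mem_left _ c (Ideal.mem_span_singleton_self _)

/-- **Multiplication by `t^{a-b}`**: `S ⧸ (t^b) → S ⧸ (t^a)`, `S`-linear. [folklore] -/
def tup (a b : ℕ) (h : b ≤ a) : C t b →ₗ[S] C t a :=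
  Submodule.mapQ _ _ (t ^ (a - b) • (LinearMap.id : S →ₗ[S] S)) (span_pow_le_comap t a b h)

/-- `tup` on classes. [folklore] -/
@[simp] theorem tup_mk (a b : ℕ) (h : b ≤ a) (x : S) :
    tup t a b h (Ideal.Quotient.mk _ x) = Ideal.Quotient.mk _ (t ^ (a - b) * x) := rfl

/-! ## Identities -/

/-- `red` is onto. [folklore] -/
theorem red_surjective (a b : ℕ) (h : b ≤ a) : Function.Surjective (red t a b h) := fun x => by
  obtain ⟨s, rfl⟩ := Ideal.Quotient.mk_surjective x
  exact ⟨Ideal.Quotient.mk _ s, rfl⟩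

/-- `red ∘ tup = t^{a-b}`. [folklore] -/
theorem red_tup (a b : ℕ) (h : b ≤ a) (x : C t b) : red t a b h (tup t a b h x) = t ^ (a - b) • x := by
  obtain ⟨s, rfl⟩ := Ideal.Quotient.mk_surjective x
  rw [tup_mk, red_mk, Algebra.smul_def, Ideal.Quotient.algebraMap_eq, map_mul]

/-- `tup ∘ red = t^{a-b}`. [folklore] -/
theorem tup_red (a b : ℕ) (h : b ≤ a) (x : C t a) : tup t a b h (red t a b h x) = t ^ (a - b) • x := by
  obtain ⟨s, rfl⟩ := Ideal.Quotient.mk_surjective x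
  rw [red_mk, tup_mk, Algebra.smul_def, Ideal.Quotient.algebraMap_eq, map_mul]

/-- `red_{b→c} ∘ red_{a→b} = red_{a→c}`. [folklore] -/
theorem red_red (a b c : ℕ) (hba : b ≤ a) (hcb : c ≤ b) (x : C t a) :
    red t b c hcb (red t a b hba x) = red t a c (hcb.trans hba) x := by
  obtain ⟨s, rfl⟩ := Ideal.Quotient.mk_surjective x
  rfl

/-- `red_{a→a} = id`. [folklore] -/
theorem red_self (a : ℕ) (x : C t a) : red t a a le_rfl x = x := by
  obtain ⟨s, rfl⟩ := Ideal.Quotient.mk_surjective x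
  rfl

/-- `tup_{b→a} ∘ tup_{c→b} = tup_{c→a}`. [folklore] -/
theorem tup_tup (a b c : ℕ) (hba : b ≤ a) (hcb : c ≤ b) (x : C t c) :
    tup t a b hba (tup t b c hcb x) = tup t a c (hcb.trans hba) x := by
  obtain ⟨s, rfl⟩ := Ideal.Quotient.mk_surjective x
  rw [tup_mk, tup_mk, tup_mk, ← mul_assoc, ← pow_add,
    show a - b + (b - c) = a - c by omega]

/-- `red_{a→b} ∘ tup_{(a-b)→a} = 0`: reducing a `t^b`-multiple modulo `t^b`. [folklore] -/
theorem red_tup_sub (a b : ℕ) (h : b ≤ a) (x : C t (a - b)) :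
    red t a b h (tup t a (a - b) (Nat.sub_le a b) x) = 0 := by
  obtain ⟨s, rfl⟩ := Ideal.Quotient.mk_surjective x
  rw [tup_mk, red_mk, Ideal.Quotient.eq_zero_iff_mem, Nat.sub_sub_self h]
  exact Ideal.mul_mem_right _ _ (Ideal.mem_span_singleton_self _)

/-- **Semilinearity of `tup`** over `red`: `tup (red x · z) = x · tup z`. [folklore] -/
theorem tup_red_mul (a b : ℕ) (h : b ≤ a) (x : C t a) (z : C t b) :
    tup t a b h (red t a b h x * z) = x * tup t a b h z := by
  obtain ⟨s, rfl⟩ := Ideal.Quotient.mk_surjective x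
  obtain ⟨w, rfl⟩ := Ideal.Quotient.mk_surjective z
  rw [red_mk, ← map_mul, tup_mk, tup_mk, ← map_mul, mul_left_comm]

/-- `red_{a→b} ∘ tup_{c→a} = tup_{c→b} ∘ (t^{a-b} •)`… in the useful form: for `c ≤ b ≤ a`,
`red_{a→b} (tup_{c→a} x) = t^{a-b} • tup_{c→b} x`. [folklore] -/
theorem red_tup_of_le (a b c : ℕ) (hba : b ≤ a) (hcb : c ≤ b) (x : C t c) :
    red t a b hba (tup t a c (hcb.trans hba) x) = t ^ (a - b) • tup t b c hcb x := by
  obtain ⟨s, rfl⟩ := Ideal.Quotient.mk_surjective x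
  rw [tup_mk, red_mk, tup_mk, Algebra.smul_def, Ideal.Quotient.algebraMap_eq, ← map_mul,
    ← mul_assoc, ← pow_add, show a - b + (b - c) = a - c by omega]

/-- Commutation of `red` and `tup` across parallel levels: for `b ≤ a`,
`red_{(a+1)→a} ∘ tup_{(b+1)→(a+1)} = tup_{b→a} ∘ red_{(b+1)→b}`. [folklore] -/
theorem red_succ_tup_succ (a b : ℕ) (h : b ≤ a) (x : C t (b + 1)) :
    red t (a + 1) a (Nat.le_succ a) (tup t (a + 1) (b + 1) (Nat.succ_le_succ h) x) =
      tup t a b h (red t (b + 1) b (Nat.le_succ b) x) := by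
  obtain ⟨s, rfl⟩ := Ideal.Quotient.mk_surjective x
  rw [tup_mk, red_mk, red_mk, tup_mk, Nat.add_sub_add_right]

/-! ## Regular `t`: injectivity of `tup` and the kernel of `red` -/

/-- **`tup` is injective** when `t` is a non-zero-divisor. [folklore] -/
theorem tup_injective (ht : t ∈ S⁰) (a b : ℕ) (h : b ≤ a) : Function.Injective (tup t a b h) := by
  rw [injective_iff_map_eq_zero]
  intro x hx
  obtain ⟨s, rfl⟩ := Ideal.Quotient.mk_surjective x
  rw [tup_mk, Ideal.Quotient.eq_zero_iff_mem] at hx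
  obtain ⟨c, hc⟩ := Ideal.mem_span_singleton'.mp hx
  -- `c t^a = t^{a-b} s`, so `t^{a-b} (c t^b - s) = 0`
  have h1 : t ^ (a - b) * (c * t ^ b - s) = 0 := by
    rw [mul_sub, mul_left_comm, ← pow_add, Nat.sub_add_cancel h, hc, sub_self]
  have h2 : c * t ^ b - s = 0 := (mul_left_mem_nonZeroDivisors_eq_zero_iff (pow_mem ht _)).mp h1
  rw [Ideal.Quotient.eq_zero_iff_mem]
  exact Ideal.mem_span_singleton'.mpr ⟨c, by rw [← sub_eq_zero, h2]⟩

/-- **`ker red_{a→b} = im tup_{(a-b)→a}`.** [folklore] -/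
theorem exists_tup_eq_of_red_eq_zero (a b : ℕ) (h : b ≤ a) (x : C t a) (hx : red t a b h x = 0) :
    ∃ z : C t (a - b), tup t a (a - b) (Nat.sub_le a b) z = x := by
  obtain ⟨s, rfl⟩ := Ideal.Quotient.mk_surjective x
  rw [red_mk, Ideal.Quotient.eq_zero_iff_mem] at hx
  obtain ⟨c, rfl⟩ := Ideal.mem_span_singleton'.mp hx
  refine ⟨Ideal.Quotient.mk _ c, ?_⟩
  rw [tup_mk, Nat.sub_sub_self h, mul_comm]

/-- The pair `tup_{(a-b)→a}`, `red_{a→b}` is exact. [folklore] -/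
theorem exact_tup_red (a b : ℕ) (h : b ≤ a) :
    Function.Exact (tup t a (a - b) (Nat.sub_le a b)) (red t a b h).toLinearMap := by
  intro x
  constructor
  · intro hx
    obtain ⟨z, hz⟩ := exists_tup_eq_of_red_eq_zero t a b h x hx
    exact ⟨z, hz⟩
  · rintro ⟨z, rfl⟩
    exact red_tup_sub t a b h z

/-! ## The square-zero kernel of `S/(t^{a+1}) → S/(t^a)` -/

/-- **Square zero**: for `a ≥ 1`, the kernel of `S/(t^{a+1}) → S/(t^a)` has square zero.
[cite: Grothendieck1968SGA2, Exp. XI (1.1)] -/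
theorem mul_eq_zero_of_red_succ_eq_zero {a : ℕ} (ha : 1 ≤ a) (x z : C t (a + 1))
    (hx : red t (a + 1) a (Nat.le_succ a) x = 0) (hz : red t (a + 1) a (Nat.le_succ a) z = 0) :
    x * z = 0 := by
  obtain ⟨s, rfl⟩ := Ideal.Quotient.mk_surjective x
  obtain ⟨w, rfl⟩ := Ideal.Quotient.mk_surjective z
  rw [red_mk, Ideal.Quotient.eq_zero_iff_mem] at hx hz
  obtain ⟨c, rfl⟩ := Ideal.mem_span_singleton'.mp hx
  obtain ⟨d, rfl⟩ := Ideal.mem_span_singleton'.mp hz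
  rw [← map_mul, Ideal.Quotient.eq_zero_iff_mem]
  have h1 : c * t ^ a * (d * t ^ a) = (c * d * t ^ (a - 1)) * t ^ (a + 1) := by
    have : t ^ a * t ^ a = t ^ (a - 1) * t ^ (a + 1) := by
      rw [← pow_add, ← pow_add]; congr 1; omega
    calc c * t ^ a * (d * t ^ a) = c * d * (t ^ a * t ^ a) := by ring
      _ = c * d * t ^ (a - 1) * t ^ (a + 1) := by rw [this]; ring
  rw [h1]
  exact Ideal.mul_mem_left _ _ (Ideal.mem_span_singleton_self _)

/-- The kernel of `red_{(a+1)→a}` is the image of `tup_{1→(a+1)}`. [folklore] -/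
theorem ker_red_succ_eq_range_tup (a : ℕ) :
    LinearMap.ker (red t (a + 1) a (Nat.le_succ a)).toLinearMap =
      LinearMap.range (tup t (a + 1) 1 (Nat.le_add_left 1 a)) := by
  ext x
  rw [LinearMap.mem_ker, LinearMap.mem_range]
  constructor
  · intro hx
    obtain ⟨z, hz⟩ := exists_tup_eq_of_red_eq_zero t (a + 1) a (Nat.le_succ a) x hx
    have h1 : a + 1 - a = 1 := by omega
    -- transport `z : C t (a + 1 - a)` to `C t 1`
    obtain ⟨s, rfl⟩ := Ideal.Quotient.mk_surjective z
    refine ⟨Ideal.Quotient.mk _ s, ?_⟩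
    rw [← hz, tup_mk, tup_mk, Nat.sub_sub_self (Nat.le_succ a), show a + 1 - 1 = a from rfl]
  · rintro ⟨z, rfl⟩
    obtain ⟨s, rfl⟩ := Ideal.Quotient.mk_surjective z
    rw [AlgHom.toLinearMap_apply, tup_mk, red_mk, Ideal.Quotient.eq_zero_iff_mem,
      show a + 1 - 1 = a from rfl]
    exact Ideal.mul_mem_right _ _ (Ideal.mem_span_singleton_self _)

/-- **The kernel of `S/(t^{a+1}) → S/(t^a)` is `S/(t)`** (`S`-linearly, via `t^a`), for `t` a
non-zero-divisor. [cite: Grothendieck1968SGA2, Exp. XI (1.1)] -/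
def kerRedSuccEquiv (ht : t ∈ S⁰) (a : ℕ) :
    C t 1 ≃ₗ[S] LinearMap.ker (red t (a + 1) a (Nat.le_succ a)).toLinearMap :=
  (LinearEquiv.ofInjective (tup t (a + 1) 1 (Nat.le_add_left 1 a))
    (tup_injective t ht (a + 1) 1 _)).trans (LinearEquiv.ofEq _ _ (ker_red_succ_eq_range_tup t a).symm)

/-- `kerRedSuccEquiv` on elements. [folklore] -/
theorem kerRedSuccEquiv_apply (ht : t ∈ S⁰) (a : ℕ) (x : C t 1) :
    ((kerRedSuccEquiv t ht a x : LinearMap.ker (red t (a + 1) a (Nat.le_succ a)).toLinearMap) :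
      C t (a + 1)) = tup t (a + 1) 1 (Nat.le_add_left 1 a) x := rfl

/-- **Regular sequences transfer to the kernel**: an `S/(t)`-(weakly) regular sequence of
elements of `S` is (weakly) regular on the kernel of `S/(t^{a+1}) → S/(t^a)`. [folklore] -/
theorem isWeaklyRegular_ker_red_succ (ht : t ∈ S⁰) (a : ℕ) {rs : List S}
    (hrs : RingTheory.Sequence.IsWeaklyRegular (C t 1) rs) :
    RingTheory.Sequence.IsWeaklyRegular
      (LinearMap.ker (red t (a + 1) a (Nat.le_succ a)).toLinearMap) rs :=
  (LinearEquiv.isWeaklyRegular_congr (kerRedSuccEquiv t ht a) rs).mp hrs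

/-! ## Level zero -/

/-- Level `0` is the zero ring. [folklore] -/
theorem subsingleton_C_zero : Subsingleton (C t 0) := by
  refine ⟨fun x z => ?_⟩
  obtain ⟨s, rfl⟩ := Ideal.Quotient.mk_surjective x
  obtain ⟨w, rfl⟩ := Ideal.Quotient.mk_surjective z
  apply (Ideal.Quotient.mk_eq_mk_iff_sub_mem s w).mpr
  rw [pow_zero, Ideal.span_singleton_one]
  exact Submodule.mem_top

end AdicLevel

end Literature.RingTheory.RegularLocalRing

end
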